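import Mathlib.NumberTheory.Padics.Complex
import Mathlib.LinearAlgebra.Matrix.Charpoly.Coeff
import Literature.NumberTheory.GaloisRepresentations.FramedRepTwist
import Literature.NumberTheory.GaloisRepresentations.CyclotomicCharacterFrobeniusProofs
import HarnessLib

/-!
# Tate twists of framed `ℓ`-adic Galois representations: unramifiedness and Frobenius
# characteristic polynomials (pure proofs)

Topic `NumberTheory/GaloisRepresentations`; theorems only (no definition, no named fact).
For a number field `K`, a prime `ℓ`, a framed continuous representation
`r : Γ_K →ₜ* GL_n(ℚ̄_ℓ)` (`FramedGaloisRep K (PadicAlgCl ℓ) n`) and an integer `k`, the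
**Tate twist** `r ⊗ ε_ℓ^k` (`FramedRep.twist` of `FramedRepTwist` by the `k`-th power of the
`ℓ`-adic cyclotomic character `GaloisRep.cyclotomicCharacter K ℓ`, pushed into `ℚ̄_ℓˣ`) is again
unramified at every finite place `v ∤ ℓ` where `r` is, and if the arithmetic Frobenius at `v` has
characteristic polynomial `∏_{b ∈ β} (X - b)` on `r` then it has characteristic polynomial
`∏_{b ∈ β} (X - q_v^k b)` on `r ⊗ ε_ℓ^k` (`q_v = N v`), because `ε_ℓ` is unramified at `v ∤ ℓ`
(`FramedGaloisRep.isUnramifiedAt_cyclotomic_holds`) with `ε_ℓ(Frob_v) = q_v` for the arithmetic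
Frobenius (`GaloisRep.cyclotomicCharacter_apply_of_isArithFrobAt`).  Serre, *Abelian `ℓ`-adic
representations and elliptic curves* (1968), Ch. I §1.2 (Example: `χ_ℓ`, "`V_ℓ(μ)`", Tate twists).

As in `FramedRepTwistEulerFactorProofs`, the twisting character is not introduced as a new
definition: the statements quantify over a continuous character `ε : Γ_K →ₜ* ℚ̄_ℓˣ` with the
pointwise identity `ε(σ) = χ_ℓ(σ)^k` (`hε`), and `exists_cyclotomicCharacter_padicAlgCl_zpow`
constructs one.

## Contents

* `Matrix.charmatrix_smul_eq`, `Matrix.charpoly_smul_of_eq_prod` — over a field, if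
  `charpoly M = ∏_{b ∈ β} (X - b)` and `c ≠ 0` then `charpoly (c • M) = ∏_{b ∈ β} (X - c b)`
  (`charmatrix (c M) = c · (charmatrix M)(c⁻¹ X)` entrywise, `RingHom.map_det`).
* `FramedGaloisRep.isUnramifiedAt_twist`, `FramedGaloisRep.hasFrobCharpolyAt_twist_of_eq_prod` —
  twisting by a character trivial on the inertia groups above `v` preserves unramifiedness at `v`;
  a character with constant value `c` on the arithmetic Frobenii above `v` rescales the roots of
  the Frobenius characteristic polynomial by `c`.
* `exists_cyclotomicCharacter_padicAlgCl_zpow`, `eq_one_of_mem_inertia_of_cyclotomic_zpow`,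
  `coe_apply_of_isArithFrobAt_of_cyclotomic_zpow` — `ε_ℓ^k` with values in `ℚ̄_ℓˣ`: existence,
  triviality on inertia at `v ∤ ℓ`, value `q_v^k` on arithmetic Frobenii.
* `FramedGaloisRep.exists_tateTwist` — the assembled statement displayed above.

Used by `Automorphic/WeaklyRegularGaloisRep` (passage between the Galois representations of `π`
and of `π ⊗ ‖det‖^k`).

## References

* J.-P. Serre, *Abelian ℓ-adic representations and elliptic curves*, Benjamin (1968), Ch. I
  §1.2 (Example: the cyclotomic character; Tate twists). [SerreAbelianLadic1968]
-/

noncomputable section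

open scoped NumberField
open IsDedekindDomain Field Polynomial

namespace Literature.NumberTheory.GaloisRepresentations

/-! ### The characteristic polynomial of a rescaled matrix -/

section Charpoly

variable {F : Type*} [Field F] {m : Type*} [Fintype m] [DecidableEq m]

/-- `charmatrix (c • M) = C c • (charmatrix M)(c⁻¹ X)` for `c ≠ 0` (entrywise:
`X - c Mᵢᵢ = c (c⁻¹ X - Mᵢᵢ)` and `-c Mᵢⱼ = c (-Mᵢⱼ)`). [folklore] -/
theorem Matrix.charmatrix_smul_eq (M : Matrix m m F) {c : F} (hc : c ≠ 0) :
    Matrix.charmatrix (c • M) =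
      C c • (Polynomial.compRingHom (C c⁻¹ * X)).mapMatrix (Matrix.charmatrix M) := by
  refine Matrix.ext fun i j => ?_
  simp only [Matrix.smul_apply, RingHom.mapMatrix_apply, Matrix.map_apply,
    Polynomial.coe_compRingHom_apply, smul_eq_mul]
  by_cases h : i = j
  · subst h
    rw [Matrix.charmatrix_apply_eq, Matrix.charmatrix_apply_eq, Matrix.smul_apply, smul_eq_mul,
      Polynomial.sub_comp, Polynomial.X_comp, Polynomial.C_comp, mul_sub, ← mul_assoc, ← C_mul,
      mul_inv_cancel₀ hc, C_1, one_mul, ← C_mul]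
  · rw [Matrix.charmatrix_apply_ne _ _ _ h, Matrix.charmatrix_apply_ne _ _ _ h, Matrix.smul_apply,
      smul_eq_mul, Polynomial.neg_comp, Polynomial.C_comp, mul_neg, ← C_mul]

/-- **Rescaling a matrix rescales the roots of its characteristic polynomial**: over a field, if
`charpoly M = ∏_{b ∈ β} (X - b)` and `c ≠ 0`, then `charpoly (c • M) = ∏_{b ∈ β} (X - c b)`
(`det` of `charmatrix_smul_eq` through `RingHom.map_det`; `card β = dim` by degrees). [folklore] -/
theorem Matrix.charpoly_smul_of_eq_prod {M : Matrix m m F} {β : Multiset F}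
    (hM : M.charpoly = (β.map fun b => X - C b).prod) {c : F} (hc : c ≠ 0) :
    (c • M).charpoly = (β.map fun b => X - C (c * b)).prod := by
  have hcard : Multiset.card β = Fintype.card m := by
    have h1 := Matrix.charpoly_natDegree_eq_dim M
    rwa [hM, Polynomial.natDegree_multiset_prod_X_sub_C_eq_card] at h1
  set φ : F[X] →+* F[X] := Polynomial.compRingHom (C c⁻¹ * X) with hφ
  calc (c • M).charpoly = (C c • φ.mapMatrix (Matrix.charmatrix M)).det := by
          rw [Matrix.charpoly, Matrix.charmatrix_smul_eq M hc]
    _ = C c ^ Fintype.card m * φ M.charpoly := by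
          rw [Matrix.det_smul, Matrix.charpoly, RingHom.map_det]
    _ = C c ^ Multiset.card β * (β.map fun b => C c⁻¹ * X - C b).prod := by
          rw [hcard, hM, map_multiset_prod, Multiset.map_map]
          congr 2
          refine Multiset.map_congr rfl fun b _ => ?_
          simp only [Function.comp_apply, hφ, Polynomial.coe_compRingHom_apply, Polynomial.sub_comp,
            Polynomial.X_comp, Polynomial.C_comp]
    _ = (β.map fun b => C c * (C c⁻¹ * X - C b)).prod := by
          rw [Multiset.prod_map_mul, Multiset.map_const', Multiset.prod_replicate]
    _ = (β.map fun b => X - C (c * b)).prod := by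
          congr 1
          refine Multiset.map_congr rfl fun b _ => ?_
          rw [mul_sub, ← mul_assoc, ← C_mul, mul_inv_cancel₀ hc, C_1, one_mul, ← C_mul]

end Charpoly

/-! ### Twisting framed Galois representations by characters unramified at `v` -/

section Twist

variable {K : Type} [Field K] {A : Type*} [CommRing A] [TopologicalSpace A] [IsTopologicalRing A]
  {n : ℕ}

/-- **Twisting by a character trivial on the inertia groups above `v` preserves unramifiedness
at `v`**: `(ρ ⊗ χ)(σ) = χ(σ) ρ(σ) = 1` for `σ ∈ I_𝔓`, `𝔓 ∣ v`.
[cite: SerreAbelianLadic1968, Ch. I §2.1] -/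
theorem FramedGaloisRep.isUnramifiedAt_twist {v : HeightOneSpectrum (𝓞 K)}
    {ρ : FramedGaloisRep K A n} (hρ : ρ.IsUnramifiedAt v) {χ : absoluteGaloisGroup K →ₜ* Aˣ}
    (hχ : ∀ 𝔓 ∈ v.primesAbove, ∀ σ ∈ 𝔓.inertia (absoluteGaloisGroup K), χ σ = 1) :
    FramedGaloisRep.IsUnramifiedAt v (FramedRep.twist ρ χ) := by
  intro 𝔓 h𝔓 σ hσ
  rw [FramedRep.twist_apply_of_eq_one _ _ (hχ 𝔓 h𝔓 σ hσ)]
  exact hρ 𝔓 h𝔓 σ hσ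

variable {F : Type*} [Field F] [TopologicalSpace F] [IsTopologicalRing F]

/-- **Twisting rescales the Frobenius characteristic polynomial**: if the arithmetic Frobenii
above `v` have characteristic polynomial `∏_{b ∈ β} (X - b)` on `ρ` and `χ` takes the constant
value `c` on them, then they have characteristic polynomial `∏_{b ∈ β} (X - c b)` on `ρ ⊗ χ`
(`(ρ ⊗ χ)(σ) = c • ρ(σ)` as a matrix, `Matrix.charpoly_smul_of_eq_prod`; `c ≠ 0` as a value of
`χ`). [cite: SerreAbelianLadic1968, Ch. I §2.3] -/
theorem FramedGaloisRep.hasFrobCharpolyAt_twist_of_eq_prod {v : HeightOneSpectrum (𝓞 K)}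
    {ρ : FramedGaloisRep K F n} {β : Multiset F}
    (hρ : ρ.HasFrobCharpolyAt v (β.map fun b => X - C b).prod)
    {χ : absoluteGaloisGroup K →ₜ* Fˣ} {c : F}
    (hχ : ∀ 𝔓 ∈ v.primesAbove, ∀ σ : absoluteGaloisGroup K, IsArithFrobAt (𝓞 K) σ 𝔓 →
      (χ σ : F) = c) :
    FramedGaloisRep.HasFrobCharpolyAt v ((β.map fun b => X - C (c * b)).prod)
      (FramedRep.twist ρ χ) := by
  intro 𝔓 h𝔓 σ hσ
  have hc : c ≠ 0 := by
    rw [← hχ 𝔓 h𝔓 σ hσ]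
    exact (χ σ).ne_zero
  change Matrix.charpoly ((FramedRep.twist ρ χ σ : GL (Fin n) F) : Matrix (Fin n) (Fin n) F) = _
  rw [FramedRep.coe_twist_apply, hχ 𝔓 h𝔓 σ hσ]
  exact Matrix.charpoly_smul_of_eq_prod (hρ 𝔓 h𝔓 σ hσ) hc

end Twist

/-! ### Powers of the cyclotomic character with values in `ℚ̄_ℓˣ` -/

section Cyclotomic

variable {K : Type} [Field K] {ℓ : ℕ} [Fact ℓ.Prime]

variable (K ℓ) in
/-- **The character `ε_ℓ^k : Γ_K →ₜ* ℚ̄_ℓˣ` exists**: the `ℓ`-adic cyclotomic character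
(`GaloisRep.cyclotomicCharacter K ℓ`, values in `ℤ_ℓˣ`) pushed along the continuous ring
homomorphism `ℤ_ℓ → ℚ_ℓ → ℚ̄_ℓ` (`PadicAlgCl ℓ`, Mathlib) and raised to the `k`-th power
(`zpowGroupHom`, `continuous_zpow`). [cite: SerreAbelianLadic1968, Ch. I §1.2 (Example: the cyclotomic character)] -/
theorem exists_cyclotomicCharacter_padicAlgCl_zpow (k : ℤ) :
    ∃ ε : absoluteGaloisGroup K →ₜ* (PadicAlgCl ℓ)ˣ,
      ∀ σ, (ε σ : PadicAlgCl ℓ) =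
        (algebraMap ℚ_[ℓ] (PadicAlgCl ℓ)
          ((GaloisRep.cyclotomicCharacter K ℓ σ : ℤ_[ℓ]ˣ) : ℤ_[ℓ])) ^ k := by
  set f : ℤ_[ℓ] →+* PadicAlgCl ℓ := (algebraMap ℚ_[ℓ] (PadicAlgCl ℓ)).comp PadicInt.Coe.ringHom
    with hf
  have hfc : Continuous f :=
    (continuous_algebraMap ℚ_[ℓ] (PadicAlgCl ℓ)).comp continuous_subtype_val
  let ε₁ : absoluteGaloisGroup K →ₜ* (PadicAlgCl ℓ)ˣ :=
    { toMonoidHom := (Units.map f.toMonoidHom).comp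
        (GaloisRep.cyclotomicCharacter K ℓ).toMonoidHom
      continuous_toFun := (Continuous.units_map _ hfc).comp
        (GaloisRep.cyclotomicCharacter K ℓ).continuous }
  refine ⟨{ toMonoidHom := (zpowGroupHom k).comp ε₁.toMonoidHom
            continuous_toFun := (continuous_zpow k).comp ε₁.continuous }, fun σ => ?_⟩
  change (((ε₁ σ) ^ k : (PadicAlgCl ℓ)ˣ) : PadicAlgCl ℓ) = _
  rw [Units.val_zpow_eq_zpow_val]
  rfl

variable [NumberField K]

/-- `ε_ℓ^k` is **trivial on the inertia groups** at every finite place `v ∤ ℓ` (the cyclotomic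
character is unramified away from `ℓ`, `FramedGaloisRep.isUnramifiedAt_cyclotomic_holds`).
[cite: SerreAbelianLadic1968, Ch. I §1.2 (Example: the cyclotomic character)] -/
theorem eq_one_of_mem_inertia_of_cyclotomic_zpow {k : ℤ}
    {ε : absoluteGaloisGroup K →ₜ* (PadicAlgCl ℓ)ˣ}
    (hε : ∀ σ, (ε σ : PadicAlgCl ℓ) =
      (algebraMap ℚ_[ℓ] (PadicAlgCl ℓ)
        ((GaloisRep.cyclotomicCharacter K ℓ σ : ℤ_[ℓ]ˣ) : ℤ_[ℓ])) ^ k)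
    {v : HeightOneSpectrum (𝓞 K)} (hv : ((ℓ : ℕ) : 𝓞 K) ∉ v.asIdeal)
    {𝔓 : Ideal (absIntegers (𝓞 K) K)} (h𝔓 : 𝔓 ∈ v.primesAbove)
    {σ : absoluteGaloisGroup K} (hσ : σ ∈ 𝔓.inertia (absoluteGaloisGroup K)) :
    ε σ = 1 := by
  have h1 : GaloisRep.cyclotomicCharacter K ℓ σ = 1 := by
    have h := FramedGaloisRep.isUnramifiedAt_cyclotomic_holds K ℓ hv 𝔓 h𝔓 σ hσ
    rw [← FramedGaloisRep.det_cyclotomic_apply K ℓ σ, FramedRep.det_apply, h, map_one]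
  refine Units.ext ?_
  rw [hε σ, h1, Units.val_one, Units.val_one, PadicInt.coe_one, map_one, one_zpow]

/-- `ε_ℓ^k` takes the **value `q_v^k` on the arithmetic Frobenii** above a finite place `v ∤ ℓ`
(`GaloisRep.cyclotomicCharacter_apply_of_isArithFrobAt`: `χ_ℓ(Frob_v) = N v`).
[cite: SerreAbelianLadic1968, Ch. I §1.2 (Example: the cyclotomic character)] -/
theorem coe_apply_of_isArithFrobAt_of_cyclotomic_zpow {k : ℤ}
    {ε : absoluteGaloisGroup K →ₜ* (PadicAlgCl ℓ)ˣ}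
    (hε : ∀ σ, (ε σ : PadicAlgCl ℓ) =
      (algebraMap ℚ_[ℓ] (PadicAlgCl ℓ)
        ((GaloisRep.cyclotomicCharacter K ℓ σ : ℤ_[ℓ]ˣ) : ℤ_[ℓ])) ^ k)
    {v : HeightOneSpectrum (𝓞 K)} (hv : ((ℓ : ℕ) : 𝓞 K) ∉ v.asIdeal)
    {𝔓 : Ideal (absIntegers (𝓞 K) K)} (h𝔓 : 𝔓 ∈ v.primesAbove)
    {σ : absoluteGaloisGroup K} (hσ : IsArithFrobAt (𝓞 K) σ 𝔓) :
    (ε σ : PadicAlgCl ℓ) = (v.residueCard : PadicAlgCl ℓ) ^ k := by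
  rw [hε σ, GaloisRep.cyclotomicCharacter_apply_of_isArithFrobAt hv h𝔓 hσ, PadicInt.coe_natCast,
    map_natCast]

/-- **Tate twists of framed `ℓ`-adic Galois representations.** For `r : Γ_K →ₜ* GL_n(ℚ̄_ℓ)` and
`k ∈ ℤ` there is `r' = r ⊗ ε_ℓ^k` such that at every finite place `v ∤ ℓ`: if `r` is unramified
at `v` then so is `r'`, and if the arithmetic Frobenius at `v` has characteristic polynomial
`∏_{b ∈ β} (X - b)` on `r` then it has characteristic polynomial `∏_{b ∈ β} (X - q_v^k b)` on `r'`.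
[cite: SerreAbelianLadic1968, Ch. I §1.2 (Example: the cyclotomic character)] -/
theorem FramedGaloisRep.exists_tateTwist {n : ℕ} (r : FramedGaloisRep K (PadicAlgCl ℓ) n) (k : ℤ) :
    ∃ r' : FramedGaloisRep K (PadicAlgCl ℓ) n,
      ∀ v : HeightOneSpectrum (𝓞 K), ((ℓ : ℕ) : 𝓞 K) ∉ v.asIdeal →
        (r.IsUnramifiedAt v → r'.IsUnramifiedAt v) ∧
        ∀ β : Multiset (PadicAlgCl ℓ),
          r.HasFrobCharpolyAt v (β.map fun b => X - C b).prod →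
            r'.HasFrobCharpolyAt v
              ((β.map fun b => X - C ((v.residueCard : PadicAlgCl ℓ) ^ k * b)).prod) := by
  obtain ⟨ε, hε⟩ := exists_cyclotomicCharacter_padicAlgCl_zpow K ℓ k
  refine ⟨FramedRep.twist r ε, fun v hv => ⟨fun hr => ?_, fun β hr => ?_⟩⟩
  · exact FramedGaloisRep.isUnramifiedAt_twist hr fun 𝔓 h𝔓 σ hσ =>
      eq_one_of_mem_inertia_of_cyclotomic_zpow hε hv h𝔓 hσ
  · exact FramedGaloisRep.hasFrobCharpolyAt_twist_of_eq_prod hr fun 𝔓 h𝔓 σ hσ =>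
      coe_apply_of_isArithFrobAt_of_cyclotomic_zpow hε hv h𝔓 hσ

end Cyclotomic

end Literature.NumberTheory.GaloisRepresentations
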